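import Summits.BirchSwinnertonDyer.BirchSwinnertonDyer.Theorems.ManinLocalTwoThreeStevensCuspLimits
import Summits.BirchSwinnertonDyer.BirchSwinnertonDyer.Theorems.ManinLocalTwoThreeStevensXRational
import Summits.BirchSwinnertonDyer.BirchSwinnertonDyer.Theorems.ManinLocalTwoThreeStevensXPresentation
import Summits.BirchSwinnertonDyer.BirchSwinnertonDyer.Theorems.ManinLocalTwoThreeCDivisionCuspSeries
import Literature.NumberTheory.ModularForms.GammaTranslatesGaloisAction
import Literature.NumberTheory.ModularForms.GammaTranslatesSetup
import Literature.NumberTheory.EllipticCurves.Gamma1ParametrizationCuspGaloisAction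
import HarnessLib

/-!
# Stevens 1982 Thm 1.3.1 (b) PROVED: the Galois action on the cusp values of an `X₁(N)`-parametrisation
# (`optimalGamma1Parametrization_cuspInv_galoisAction` holds — T-es-75 of cell bsd-f2-manin)
(route `ManinLocalTwoThree`, crux C2 `ManinOddAtFour` stmt-BirchSwinnertonDyer-22967; prover seat p1 gen 22; `--supports 22967`).
THEOREM (`optimalGamma1Parametrization_cuspInv_galoisAction_holds`).  For every elliptic `W/ℚ`, every `X₁(N)`-datum `D` (the
hypothesis `D.IsOptimal` of the named fact is NOT used), every `σ ∈ Aut_ℚ(ℂ)` with `σ(e^{2πi/N}) = e^{2πid/N}`, `dd′ ≡ 1 (N)`, and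
every `y ≠ 0`:  `σ(u(c·{∞,1/y}_f)) = u(c·{∞,1/(d′y)}_f)`.

PROOF (analytic; no model of `X₁(N)` over `ℚ`).  Let `L₁ = c⁻¹Λ_W`, `X = ℘_{L₁}(ℰ_f)`, `Y = ℘'_{L₁}(ℰ_f)`, so that
`u(c·z) = (c⁻²℘_{L₁}(z) − b₂/12, (c⁻³℘'_{L₁}(z) − a₁x − a₃)/2)` off the lattice.  By `…StevensXPresentation` /
`…StevensXRational` / `…StevensYPresentation`, `X = A/H` and `Y = B/H_Y` with `A, H, B = H·ϑA − A·ϑH, H_Y = f·H²` holomorphic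
forms on `Γ₁(N) ⊆ Γ(N)` with RATIONAL `q_N`-expansions.  By the Galois-action half of the `q`-expansion principle for translates
(`Literature…GammaTranslatesGaloisAction.qExpansion_slash_conj`: Shimura §6.2 / Diamond–Shurman §7.7 run with the tree's Eisenstein
series `G_k^a`), the `q_N`-expansions of the translates by `γ′ = (1,0;d′y,1)` are the `σ`-conjugates of those by `γ = (1,0;y,1)`.
The values at the cusps `γ∞ = 1/y`, `γ′∞ = 1/(d′y)` are read off these expansions (`…StevensCuspLimits`: `ℰ_f(γτ) = {∞,1/y}_f + V(τ)`,
`V → 0`; `…StevensCuspValues`: transport of limits/poles under `σ`).  Hence `℘_{L₁}({∞,1/(d′y)}) = σ(℘_{L₁}({∞,1/y}))`, the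
same for `℘'`, or both values are lattice points; the coordinates of `u` are rational expressions in these.
HONEST FRAMING.  This discharges the printed fact T-es-75 (Stevens 1982, Thm. 1.3.1 (b), in the tree's analytic rendering) — one of
the two hypotheses of the C2 closer of record `maninLocalTwoThree_maninOddAtFour_of_CDT_of_cuspInvGaloisAction` (p763620); the other,
CDT (Calegari–Dimitrov–Tang 2025, Thm. 1), remains a hypothesis.  BSD is not proved; Manin's conjecture is not proved; C2 stays OPEN
as filed (conditional on CDT).  No definitions, no sorry.
[cite: Stevens1982, §1.3 Thm. 1.3.1 (b)] [cite: ShimuraIATAF1971, §6.2 Thm. 6.6, Prop. 6.9] [cite: DiamondShurman2005, §7.7] -/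

set_option linter.dupNamespace false
set_option autoImplicit false

noncomputable section

open Complex Filter Topology Set Function PowerSeries
open UpperHalfPlane hiding I
open scoped Real Topology Manifold MatrixGroups PeriodPair ModularForm
open ModularForm CongruenceSubgroup Derivative
open Literature.NumberTheory.EllipticCurves Literature.NumberTheory.EllipticCurves.ModularForms
open Summit.BirchSwinnertonDyer.BirchSwinnertonDyer.Theorems.ManinLocalTwoThree.KummerCubeSigmaLeaves (hasSum_coeff_mul_pow_mul)

namespace Summit.BirchSwinnertonDyer.BirchSwinnertonDyer.Theorems.ManinLocalTwoThree.StevensGalois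

variable {N : ℕ} [NeZero N]

/-! ## §1 Small bookkeeping -/

omit [NeZero N] in
/-- Slashing by a fixed `γ` is injective on functions. [folklore] -/
private theorem slash_ne_zero' {k : ℤ} {f : ℍ → ℂ} (hf : f ≠ 0) (γ : SL(2, ℤ)) : f ∣[k] γ ≠ 0 := by
  intro h0
  apply hf
  have := congrArg (fun g : ℍ → ℂ ↦ g ∣[k] γ⁻¹) h0
  simpa only [← SlashAction.slash_mul, mul_inv_cancel, SlashAction.slash_one, SlashAction.zero_slash] using this

/-- `M_k(Γ₁(N)) ⊆ M_k(Γ(N))`. [folklore] -/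
private theorem memΓ {k : ℤ} {A : ℍ → ℂ} (hA : A ∈ formSpace (Gamma1 N : Subgroup (GL (Fin 2) ℝ)) k) :
    A ∈ formSpace (CongruenceSubgroup.Gamma N : Subgroup (GL (Fin 2) ℝ)) k :=
  formSpace_mono (Subgroup.map_mono (Gamma_le_Gamma1 N)) hA

/-- `M_k(Γ₀(N)) ⊆ M_k(Γ₁(N))`. [folklore] -/
private theorem memΓ1_of_Γ0 {k : ℤ} {A : ℍ → ℂ} (hA : A ∈ formSpace (Gamma0 N : Subgroup (GL (Fin 2) ℝ)) k) :
    A ∈ formSpace (Gamma1 N : Subgroup (GL (Fin 2) ℝ)) k :=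
  formSpace_mono (Subgroup.map_mono (Gamma1_in_Gamma0 N)) hA

/-- `Δ ∈ M₁₂(Γ₁(N))`. [folklore] -/
private theorem discriminant_mem : (ModularForm.discriminant : ℍ → ℂ) ∈ formSpace (Gamma1 N : Subgroup (GL (Fin 2) ℝ)) 12 := by
  have hle : ((Gamma1 N : Subgroup SL(2, ℤ)) : Subgroup (GL (Fin 2) ℝ)) ≤ 𝒮ℒ := by
    rintro _ ⟨g, -, rfl⟩; exact ⟨g, rfl⟩
  exact formSpace_mono hle ⟨ModularFormClass.modularForm CuspForm.discriminant, rfl⟩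

omit [NeZero N] in
/-- A member of `formSpace Γ₁(N) k` that vanishes at `i∞` is a `1`-periodic cusp function. [folklore] -/
private theorem isCuspFunction_one_of_mem {k : ℤ} {A : ℍ → ℂ} (hA : A ∈ formSpace (Gamma1 N : Subgroup (GL (Fin 2) ℝ)) k)
    (h0 : IsZeroAtImInfty A) : IsCuspFunction 1 A := by
  obtain ⟨F, rfl⟩ := hA
  have h1 : (1 : ℝ) ∈ (Gamma1 N : Subgroup (GL (Fin 2) ℝ)).strictPeriods := by
    rw [CongruenceSubgroup.strictPeriods_Gamma1]; exact AddSubgroup.mem_zmultiples _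
  exact ⟨one_pos, SlashInvariantFormClass.periodic_comp_ofComplex F h1, ModularFormClass.holo F, h0⟩

/-- Rational `q`-expansion data of a member of `M_k(Γ₁(N))` with a rational `q`-series on `ℍ`: the `q`-expansion is rational and the
`q_N`-expansion is `σ`-fixed. [cite: ShimuraIATAF1971, §2.1 and §6.2] -/
private theorem rat_and_fix {k : ℤ} {A : ℍ → ℂ} (hA : A ∈ formSpace (Gamma1 N : Subgroup (GL (Fin 2) ℝ)) k) (S : ℚ⟦X⟧)
    (hS : ∀ τ : ℍ, HasSum (fun n : ℕ ↦ ((coeff n S : ℚ) : ℂ) * Function.Periodic.qParam 1 (τ : ℂ) ^ n) (A τ)) (σ : ℂ →+* ℂ) :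
    (∀ n, ∃ r : ℚ, (qExpansion 1 A).coeff n = (r : ℂ)) ∧ (qExpansion (N : ℝ) A).map σ = qExpansion (N : ℝ) A := by
  obtain ⟨F, rfl⟩ := hA
  exact ⟨fun n ↦ ⟨_, ratCast_qExpansion_one_coeff F S hS n⟩, map_qExpansion_nat_eq_self F S hS σ⟩

/-! ## §2 The transport of the two uniformising coordinates -/

/-- **Core transport lemma.**  For an `X₁(N)`-datum `D` (`c ≠ 0`, `L₁ = c⁻¹Λ_W`), `σ : ℂ →+* ℂ` with `σ(e^{2πi/N}) = e^{2πid/N}`,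
`dd′ ≡ 1 (N)`, and integers `y, y'` with `y ≠ 0`, `y' ≠ 0`, `y' ≡ d′y (N)`: writing `z = {∞,1/y}_f`, `z' = {∞,1/y'}_f`, either both
`z, z' ∈ L₁`, or both `∉ L₁` with `℘_{L₁}(z') = σ(℘_{L₁}(z))` and `℘'_{L₁}(z') = σ(℘'_{L₁}(z))`.
[cite: Stevens1982, §1.3 Thm. 1.3.1 (b)] [cite: ShimuraIATAF1971, §6.2] -/
theorem transport_cusp_values {W : WeierstrassCurve ℚ} [W.IsElliptic] (D₁ : Gamma1ParametrizationData W N) (hc : (D₁.c : ℂ) ≠ 0)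
    (σ : ℂ →+* ℂ) {d d' : ℤ} (hσ : σ (cexp (2 * π * Complex.I / N)) = cexp (2 * π * Complex.I * d / N))
    (hdd : ((d * d' : ℤ) : ZMod N) = 1) {y y' : ℤ} (hy : y ≠ 0) (hy' : y' ≠ 0) (hyy : ((y' : ℤ) : ZMod N) = (d' : ZMod N) * (y : ZMod N)) :
    (modularSymbol D₁.f (((1 : ℤ) : ℚ) / ((y : ℤ) : ℚ)) ∈ (D₁.L.mulLeft ((D₁.c : ℂ)⁻¹) (inv_ne_zero hc)).lattice ∧
      modularSymbol D₁.f (((1 : ℤ) : ℚ) / ((y' : ℤ) : ℚ)) ∈ (D₁.L.mulLeft ((D₁.c : ℂ)⁻¹) (inv_ne_zero hc)).lattice) ∨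
    (modularSymbol D₁.f (((1 : ℤ) : ℚ) / ((y : ℤ) : ℚ)) ∉ (D₁.L.mulLeft ((D₁.c : ℂ)⁻¹) (inv_ne_zero hc)).lattice ∧
      modularSymbol D₁.f (((1 : ℤ) : ℚ) / ((y' : ℤ) : ℚ)) ∉ (D₁.L.mulLeft ((D₁.c : ℂ)⁻¹) (inv_ne_zero hc)).lattice ∧
      ℘[D₁.L.mulLeft ((D₁.c : ℂ)⁻¹) (inv_ne_zero hc)] (modularSymbol D₁.f (((1 : ℤ) : ℚ) / ((y' : ℤ) : ℚ))) =
        σ (℘[D₁.L.mulLeft ((D₁.c : ℂ)⁻¹) (inv_ne_zero hc)] (modularSymbol D₁.f (((1 : ℤ) : ℚ) / ((y : ℤ) : ℚ)))) ∧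
      ℘'[D₁.L.mulLeft ((D₁.c : ℂ)⁻¹) (inv_ne_zero hc)] (modularSymbol D₁.f (((1 : ℤ) : ℚ) / ((y' : ℤ) : ℚ))) =
        σ (℘'[D₁.L.mulLeft ((D₁.c : ℂ)⁻¹) (inv_ne_zero hc)] (modularSymbol D₁.f (((1 : ℤ) : ℚ) / ((y : ℤ) : ℚ))))) := by
  classical
  set L₁ := D₁.L.mulLeft ((D₁.c : ℂ)⁻¹) (inv_ne_zero hc) with hL₁
  have hf : D₁.f ≠ 0 := D₁.isNewformOf.1.ne_zero
  -- the two parabolic matrices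
  set γ : SL(2, ℤ) := ⟨!![1, 0; y, 1], by simp [Matrix.det_fin_two_of]⟩ with hγdef
  set γ' : SL(2, ℤ) := ⟨!![1, 0; y', 1], by simp [Matrix.det_fin_two_of]⟩ with hγ'def
  have hγ10 : (γ 1 0 : ℤ) ≠ 0 := by simpa [hγdef] using hy
  have hγ'10 : (γ' 1 0 : ℤ) ≠ 0 := by simpa [hγ'def] using hy'
  have hγq : ((γ 0 0 : ℤ) : ℚ) / ((γ 1 0 : ℤ) : ℚ) = ((1 : ℤ) : ℚ) / ((y : ℤ) : ℚ) := by simp [hγdef]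
  have hγ'q : ((γ' 0 0 : ℤ) : ℚ) / ((γ' 1 0 : ℤ) : ℚ) = ((1 : ℤ) : ℚ) / ((y' : ℤ) : ℚ) := by simp [hγ'def]
  have h00 : ((γ' 0 0 : ℤ) : ZMod N) = ((γ 0 0 : ℤ) : ZMod N) := by simp [hγdef, hγ'def]
  have h01 : ((γ' 0 1 : ℤ) : ZMod N) = (d : ZMod N) * ((γ 0 1 : ℤ) : ZMod N) := by simp [hγdef, hγ'def]
  have h10 : ((γ' 1 0 : ℤ) : ZMod N) = (d' : ZMod N) * ((γ 1 0 : ℤ) : ZMod N) := by simpa [hγdef, hγ'def] using hyy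
  have h11 : ((γ' 1 1 : ℤ) : ZMod N) = ((γ 1 1 : ℤ) : ZMod N) := by simp [hγdef, hγ'def]
  -- the `x`-presentation on `Γ₁(N)` and the denominator `H = 12·G·Δ^a`
  obtain ⟨k, a, G, A, hk, ha2, hG0, hGint, hAmem, hAzero, hAeq⟩ := exists_xPresentation_two_le D₁ hc
  set K : ℤ := k + 12 * (a : ℤ) with hK
  set H : ℍ → ℂ := fun τ ↦ 12 * G τ * ModularForm.discriminant τ ^ a with hHdef
  have hXH : ∀ τ : ℍ, eichlerIntegral D₁.f τ ∉ L₁.lattice → ℘[L₁] (eichlerIntegral D₁.f τ) * H τ = A τ := fun τ hτ ↦ by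
    rw [hHdef, ← hAeq τ hτ]; ring
  have hGmem : (⇑G : ℍ → ℂ) ∈ formSpace (Gamma1 N : Subgroup (GL (Fin 2) ℝ)) k :=
    memΓ1_of_Γ0 ⟨(G : ModularForm (Gamma0 N) k), rfl⟩
  have hHmem : H ∈ formSpace (Gamma1 N : Subgroup (GL (Fin 2) ℝ)) K := by
    have h1 : (⇑G : ℍ → ℂ) * (ModularForm.discriminant : ℍ → ℂ) ^ a ∈
        formSpace (Gamma1 N : Subgroup (GL (Fin 2) ℝ)) (k + (a : ℤ) * 12) :=
      mul_mem_formSpace hGmem (pow_mem_formSpace discriminant_mem a)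
    have h2 : H = (12 : ℂ) • ((⇑G : ℍ → ℂ) * (ModularForm.discriminant : ℍ → ℂ) ^ a) := by
      funext τ; simp only [hHdef, Pi.smul_apply, Pi.mul_apply, Pi.pow_apply, smul_eq_mul]; ring
    rw [h2, hK, show (12 : ℤ) * (a : ℤ) = (a : ℤ) * 12 by ring]
    exact Submodule.smul_mem _ _ h1
  have hH0 : H ≠ 0 := by
    obtain ⟨τ₀, hτ₀⟩ : ∃ τ₀ : ℍ, G τ₀ ≠ 0 := by
      by_contra! hall
      exact hG0 (DFunLike.ext G 0 fun τ ↦ by simpa using hall τ)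
    intro h0
    have := congrFun h0 τ₀
    simp only [hHdef, Pi.zero_apply, mul_eq_zero, OfNat.ofNat_ne_zero, false_or, pow_eq_zero_iff', ne_eq] at this
    rcases this with h | ⟨h, -⟩
    · exact hτ₀ h
    · exact ModularForm.discriminant_ne_zero τ₀ h
  have hHzero : IsZeroAtImInfty H := by
    have hG : Tendsto (fun τ : ℍ ↦ (12 : ℂ) * G τ) atImInfty (𝓝 0) := by
      simpa using (CuspFormClass.zero_at_infty G).const_mul (12 : ℂ)
    have hΔ : IsBoundedUnder (· ≤ ·) atImInfty (fun τ : ℍ ↦ ‖ModularForm.discriminant τ ^ a‖) := by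
      obtain ⟨M, B, hM⟩ := UpperHalfPlane.isBoundedAtImInfty_iff.mp (ModularFormClass.bdd_at_infty CuspForm.discriminant)
      refine ⟨M ^ a, ?_⟩
      rw [Filter.eventually_map]
      filter_upwards [(atImInfty_mem _).mpr ⟨B, fun _ h ↦ h⟩] with τ hτ
      rw [norm_pow]
      exact pow_le_pow_left₀ (norm_nonneg _) (hM τ hτ) a
    have := hG.zero_mul_isBoundedUnder_le hΔ
    refine (this.congr fun τ ↦ ?_ : Tendsto H atImInfty (𝓝 0))
    simp only [hHdef]
  -- cusp functions of period `1`, holomorphy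
  have hAcusp : IsCuspFunction 1 A := isCuspFunction_one_of_mem hAmem (by simpa using hAzero 1)
  have hHcusp : IsCuspFunction 1 H := isCuspFunction_one_of_mem hHmem hHzero
  have hAhol : MDifferentiable 𝓘(ℂ) 𝓘(ℂ) A := hAcusp.mdifferentiable
  have hHhol : MDifferentiable 𝓘(ℂ) 𝓘(ℂ) H := hHcusp.mdifferentiable
  -- the `y`-presentation: `B = H·ϑA − A·ϑH`, `H_Y = f·H²`
  set B : ℍ → ℂ := H * serreDerivative K A - A * serreDerivative K H with hBdef
  set HY : ℍ → ℂ := (⇑D₁.f : ℍ → ℂ) * H ^ 2 with hHYdef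
  have hBmem : B ∈ formSpace (Gamma1 N : Subgroup (GL (Fin 2) ℝ)) (K + (K + 2)) := bracket_mem_formSpace hAmem hHmem
  have hfmem : (⇑D₁.f : ℍ → ℂ) ∈ formSpace (Gamma1 N : Subgroup (GL (Fin 2) ℝ)) 2 :=
    memΓ1_of_Γ0 ⟨(D₁.f : ModularForm (Gamma0 N) 2), rfl⟩
  have hHYmem : HY ∈ formSpace (Gamma1 N : Subgroup (GL (Fin 2) ℝ)) (K + (K + 2)) := by
    have h := mul_mem_formSpace hfmem (pow_mem_formSpace hHmem 2)
    rw [show (2 : ℤ) + ((2 : ℕ) : ℤ) * K = K + (K + 2) by push_cast; ring] at h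
    exact h
  have hf0 : (⇑D₁.f : ℍ → ℂ) ≠ 0 := fun h0 ↦ hf (DFunLike.ext D₁.f 0 fun τ ↦ congrFun h0 τ)
  have hHY0 : HY ≠ 0 := by
    have hev := (eventually_ne_zero_of_mem_formSpace (memΓ hfmem) hf0).and (eventually_ne_zero_of_mem_formSpace (memΓ hHmem) hH0)
    obtain ⟨τ₀, hfτ, hHτ⟩ := hev.exists
    intro h0
    have := congrFun h0 τ₀
    simp only [hHYdef, Pi.mul_apply, Pi.pow_apply, Pi.zero_apply, mul_eq_zero, pow_eq_zero_iff, OfNat.ofNat_ne_zero,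
      ne_eq, not_false_eq_true] at this
    rcases this with h | h
    · exact hfτ h
    · exact hHτ h
  -- RATIONALITY: `A`, `H`, `f`, `B`, `H_Y` have `σ`-fixed `q_N`-expansions
  obtain ⟨SA, hSA⟩ := exists_ratSeries_hasSum D₁ hc ha2 G hGint A hAhol hAeq
  obtain ⟨hArat, hfixA⟩ := rat_and_fix hAmem SA hSA σ
  choose bd hbd using hGint
  -- the rational series of `H = 12·G·Δ^a` and of `f`
  have hSH : ∀ τ : ℍ, HasSum (fun n : ℕ ↦ ((coeff n (C (12 : ℚ) * PowerSeries.mk (fun n ↦ (bd n : ℚ)) *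
      ((X * formalDeltaUnit) ^ a).map (Int.castRingHom ℚ)) : ℚ) : ℂ) * Function.Periodic.qParam 1 (τ : ℂ) ^ n) (H τ) := by
    intro τ
    set q := Function.Periodic.qParam 1 (τ : ℂ) with hq
    have hGs : HasSum (fun n : ℕ ↦ coeff n ((C (12 : ℚ) * PowerSeries.mk (fun n ↦ (bd n : ℚ))).map (algebraMap ℚ ℂ)) * q ^ n)
        ((12 : ℂ) * G τ) := by
      have h := (UpperHalfPlane.hasSum_qExpansion one_pos
        (SlashInvariantFormClass.periodic_comp_ofComplex G (one_mem_strictPeriods_coe_gamma0 N))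
        (ModularFormClass.holo G) (ModularFormClass.bdd_at_infty G) τ).mul_left (12 : ℂ)
      have hfun : (fun n : ℕ ↦ coeff n ((C (12 : ℚ) * PowerSeries.mk (fun n ↦ (bd n : ℚ))).map (algebraMap ℚ ℂ)) * q ^ n) =
          fun n : ℕ ↦ (12 : ℂ) * ((qExpansion 1 ⇑G).coeff n • Function.Periodic.qParam 1 (τ : ℂ) ^ n) := by
        funext n
        rw [map_mul (PowerSeries.map (algebraMap ℚ ℂ)), map_C, PowerSeries.coeff_C_mul, coeff_map, coeff_mk, smul_eq_mul, hq,
          show (qExpansion 1 ⇑G).coeff n = cuspCoeff G n from rfl, hbd n]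
        simp only [eq_ratCast]; push_cast; ring
      rw [hfun]; exact h
    have hΔ : HasSum (fun m : ℕ ↦ ((coeff m (X * formalDeltaUnit) : ℤ) : ℂ) * q ^ m) (ModularForm.discriminant τ) :=
      Literature.NumberTheory.EllipticCurves.hasSum_X_mul_formalDeltaUnit τ
    have hΔa := CDivCuspGerm.hasSum_intCoeff_pow hΔ a
    have hΔa' : HasSum (fun n : ℕ ↦ coeff n ((((X * formalDeltaUnit) ^ a).map (Int.castRingHom ℚ)).map (algebraMap ℚ ℂ)) * q ^ n)
        (ModularForm.discriminant τ ^ a) := by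
      have hfun : (fun n : ℕ ↦ coeff n ((((X * formalDeltaUnit) ^ a).map (Int.castRingHom ℚ)).map (algebraMap ℚ ℂ)) * q ^ n) =
          fun n : ℕ ↦ ((coeff n ((X * formalDeltaUnit) ^ a) : ℤ) : ℂ) * q ^ n := by
        funext n; rw [coeff_map, coeff_map]; simp
      rw [hfun]; exact hΔa
    have hprod := hasSum_coeff_mul_pow_mul hGs hΔa'
    have hfun : (fun n : ℕ ↦ ((coeff n (C (12 : ℚ) * PowerSeries.mk (fun n ↦ (bd n : ℚ)) *
        ((X * formalDeltaUnit) ^ a).map (Int.castRingHom ℚ)) : ℚ) : ℂ) * q ^ n) =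
        fun n : ℕ ↦ coeff n ((C (12 : ℚ) * PowerSeries.mk (fun n ↦ (bd n : ℚ))).map (algebraMap ℚ ℂ) *
          (((X * formalDeltaUnit) ^ a).map (Int.castRingHom ℚ)).map (algebraMap ℚ ℂ)) * q ^ n := by
      funext n
      rw [← map_mul (PowerSeries.map (algebraMap ℚ ℂ)), coeff_map]
      rfl
    rw [hfun, show H τ = 12 * G τ * ModularForm.discriminant τ ^ a from rfl]
    exact hprod
  obtain ⟨hHrat, hfixH⟩ := rat_and_fix hHmem _ hSH σ
  have hSf : ∀ τ : ℍ, HasSum (fun n : ℕ ↦ ((coeff n (PowerSeries.mk (fun n ↦ (W.LFunction n : ℚ))) : ℚ) : ℂ) *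
      Function.Periodic.qParam 1 (τ : ℂ) ^ n) (D₁.f τ) := by
    intro τ
    have h := UpperHalfPlane.hasSum_qExpansion one_pos
      (SlashInvariantFormClass.periodic_comp_ofComplex D₁.f (one_mem_strictPeriods_coe_gamma0 N))
      (ModularFormClass.holo D₁.f) (ModularFormClass.bdd_at_infty D₁.f) τ
    have hfun : (fun n : ℕ ↦ ((coeff n (PowerSeries.mk (fun n ↦ (W.LFunction n : ℚ))) : ℚ) : ℂ) *
        Function.Periodic.qParam 1 (τ : ℂ) ^ n) = fun n : ℕ ↦ (qExpansion 1 ⇑D₁.f).coeff n • Function.Periodic.qParam 1 (τ : ℂ) ^ n := by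
      funext n
      rw [coeff_mk, smul_eq_mul, show (qExpansion 1 ⇑D₁.f).coeff n = cuspCoeff D₁.f n from rfl, D₁.isNewformOf.2 n]
      push_cast; rfl
    rw [hfun]; exact h
  obtain ⟨hfrat, hfixf⟩ := rat_and_fix hfmem _ hSf σ
  -- the bracket and `H_Y`
  have hBrat : ∀ n, ∃ r : ℚ, (qExpansion 1 B).coeff n = (r : ℂ) := exists_rat_qExpansion_one_bracket hAcusp hHcusp hArat hHrat
  have hfixB : (qExpansion (N : ℝ) B).map σ = qExpansion (N : ℝ) B := by
    obtain ⟨Bm, hBm⟩ := hBmem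
    have := map_qExpansion_nat_eq_self_of_rat Bm (by rw [hBm]; exact hBrat) σ
    rwa [hBm] at this
  have hSHY : ∀ τ : ℍ, HasSum (fun n : ℕ ↦ ((coeff n (PowerSeries.mk (fun n ↦ (W.LFunction n : ℚ)) *
      (C (12 : ℚ) * PowerSeries.mk (fun n ↦ (bd n : ℚ)) * ((X * formalDeltaUnit) ^ a).map (Int.castRingHom ℚ)) ^ 2) : ℚ) : ℂ) *
      Function.Periodic.qParam 1 (τ : ℂ) ^ n) (HY τ) := by
    intro τ
    set q := Function.Periodic.qParam 1 (τ : ℂ) with hq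
    have e : ∀ (P : ℚ⟦X⟧) (x : ℂ), HasSum (fun n : ℕ ↦ ((coeff n P : ℚ) : ℂ) * q ^ n) x ↔
        HasSum (fun n : ℕ ↦ coeff n (P.map (algebraMap ℚ ℂ)) * q ^ n) x := fun P x ↦ by
      have : (fun n : ℕ ↦ ((coeff n P : ℚ) : ℂ) * q ^ n) = fun n : ℕ ↦ coeff n (P.map (algebraMap ℚ ℂ)) * q ^ n := by
        funext n; rw [coeff_map]; rfl
      rw [this]
    have h1 := (e _ _).mp (hSf τ)
    have h2 := (e _ _).mp (hSH τ)
    have h := hasSum_coeff_mul_pow_mul h1 (hasSum_coeff_mul_pow_mul h2 h2)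
    rw [← map_mul, ← map_mul, ← pow_two] at h
    rw [e, show HY τ = D₁.f τ * (H τ * H τ) by simp [hHYdef, Pi.mul_apply, pow_two]]
    exact h
  obtain ⟨-, hfixHY⟩ := rat_and_fix hHYmem _ hSHY σ
  -- THE GALOIS ACTION ON THE TRANSLATES (Part 1)
  have hconjA := Literature.NumberTheory.ModularForms.qExpansion_slash_conj σ hσ hdd (memΓ hAmem) hfixA h00 h01 h10 h11
  have hconjH := Literature.NumberTheory.ModularForms.qExpansion_slash_conj σ hσ hdd (memΓ hHmem) hfixH h00 h01 h10 h11
  have hconjB := Literature.NumberTheory.ModularForms.qExpansion_slash_conj σ hσ hdd (memΓ hBmem) hfixB h00 h01 h10 h11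
  have hconjHY := Literature.NumberTheory.ModularForms.qExpansion_slash_conj σ hσ hdd (memΓ hHYmem) hfixHY h00 h01 h10 h11
  -- memberships of the translates in `M(Γ(N))`
  have sm := fun {w : ℤ} {F : ℍ → ℂ} (h : F ∈ formSpace (CongruenceSubgroup.Gamma N : Subgroup (GL (Fin 2) ℝ)) w) (g : SL(2, ℤ)) ↦
    Literature.NumberTheory.ModularForms.slash_mem_formSpace_Gamma h g
  -- the values `z = {∞, 1/y}`, `z' = {∞, 1/y'}`
  set z := modularSymbol D₁.f (((1 : ℤ) : ℚ) / ((y : ℤ) : ℚ)) with hzdef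
  set z' := modularSymbol D₁.f (((1 : ℤ) : ℚ) / ((y' : ℤ) : ℚ)) with hz'def
  by_cases hz : z ∈ L₁.lattice
  · -- pole at both cusps
    left
    refine ⟨hz, ?_⟩
    have hinf := tendsto_norm_slash_div_slash_atTop D₁.f hf L₁ (memΓ hHmem) hH0 hXH γ hγ10 (by rwa [hγq])
    have hinf' := tendsto_norm_div_atTop_of_conj σ (sm (memΓ hAmem) γ) (sm (memΓ hHmem) γ) (sm (memΓ hAmem) γ')
      (sm (memΓ hHmem) γ') (slash_ne_zero' hH0 γ) hconjA hconjH hinf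
    by_contra hz'
    have hfin := tendsto_slash_div_slash_weierstrassP D₁.f hf L₁ (memΓ hHmem) hH0 hXH γ' hγ'10 (by rwa [hγ'q])
    exact not_tendsto_nhds_of_tendsto_atTop hinf' _ hfin.norm
  · -- regular at both cusps
    right
    have hlimx := tendsto_slash_div_slash_weierstrassP D₁.f hf L₁ (memΓ hHmem) hH0 hXH γ hγ10 (by rwa [hγq])
    have hlimx' := tendsto_div_of_conj σ (sm (memΓ hAmem) γ) (sm (memΓ hHmem) γ) (sm (memΓ hAmem) γ')
      (sm (memΓ hHmem) γ') (slash_ne_zero' hH0 γ) hconjA hconjH hlimx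
    have hz' : z' ∉ L₁.lattice := by
      intro hz'
      have hinf := tendsto_norm_slash_div_slash_atTop D₁.f hf L₁ (memΓ hHmem) hH0 hXH γ' hγ'10 (by rwa [hγ'q])
      exact not_tendsto_nhds_of_tendsto_atTop hinf _ hlimx'.norm
    have hlimx'' := tendsto_slash_div_slash_weierstrassP D₁.f hf L₁ (memΓ hHmem) hH0 hXH γ' hγ'10 (by rwa [hγ'q])
    have hlimy := tendsto_bracket_div_weierstrassP' D₁.f hf L₁ (K := K) (memΓ hHmem) hH0 hXH γ hγ10 (by rwa [hγq])
    have hlimy' := tendsto_div_of_conj σ (sm (memΓ hBmem) γ) (sm (memΓ hHYmem) γ) (sm (memΓ hBmem) γ')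
      (sm (memΓ hHYmem) γ') (slash_ne_zero' hHY0 γ) hconjB hconjHY hlimy
    have hlimy'' := tendsto_bracket_div_weierstrassP' D₁.f hf L₁ (K := K) (memΓ hHmem) hH0 hXH γ' hγ'10 (by rwa [hγ'q])
    refine ⟨hz, hz', ?_, ?_⟩
    · rw [hγ'q] at hlimx''; rw [hγq] at hlimx'
      exact tendsto_nhds_unique hlimx'' hlimx'
    · rw [hγ'q] at hlimy''; rw [hγq] at hlimy'
      exact tendsto_nhds_unique hlimy'' hlimy'

/-! ## §3 Stevens 1982 Thm 1.3.1 (b) -/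

/-- The cusp symbol of the parabolic-type matrix `(1,0;y,1)` is `{∞, 1/y}` and lies in `Λ₁(f)` as soon as it lies in `Γ₁(N)`;
used in the degenerate level `N = 1`. [cite: Stevens1989, §2] -/
private theorem modularSymbol_mem_of_gamma1 {W : WeierstrassCurve ℚ} (D₁ : Gamma1ParametrizationData W N) (hc : (D₁.c : ℂ) ≠ 0)
    (γ : SL(2, ℤ)) (hγ : γ ∈ Gamma1 N) (hγ10 : (γ 1 0 : ℤ) ≠ 0) :
    modularSymbol D₁.f (((γ 0 0 : ℤ) : ℚ) / ((γ 1 0 : ℤ) : ℚ)) ∈ (D₁.L.mulLeft ((D₁.c : ℂ)⁻¹) (inv_ne_zero hc)).lattice := by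
  have h := cuspSymbol_mem_L₁ D₁ hc ⟨γ, Gamma1_in_Gamma0 N hγ⟩ hγ
  unfold cuspSymbol at h
  simp only [hγ10, if_false] at h
  exact h

/-- **Stevens 1982, Thm. 1.3.1 (b), PROVED** (the named Literature fact `optimalGamma1Parametrization_cuspInv_galoisAction`; its
hypothesis `D.IsOptimal` is not used): for `σ ∈ Aut_ℚ(ℂ)` with `σ(e^{2πi/N}) = e^{2πid/N}`, `dd′ ≡ 1 (N)`, the value of the
`X₁(N)`-parametrisation at the cusp `1/y` is mapped by `σ` to the value at the cusp `1/(d′y)`.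
[cite: Stevens1982, §1.3 Thm. 1.3.1 (b)] [cite: ShimuraIATAF1971, §6.2] [cite: DiamondShurman2005, §7.7] -/
theorem optimalGamma1Parametrization_cuspInv_galoisAction_holds :
    Literature.NumberTheory.EllipticCurves.ModularForms.optimalGamma1Parametrization_cuspInv_galoisAction := by
  intro W _ N _ D₁ _ σ d d' hdd hσ y hy
  classical
  have hc0 : D₁.c ≠ 0 := D₁.maninConstant_ne_zero
  have hc : (D₁.c : ℂ) ≠ 0 := by exact_mod_cast hc0
  set L₁ := D₁.L.mulLeft ((D₁.c : ℂ)⁻¹) (inv_ne_zero hc) with hL₁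
  set σ' : ℂ →+* ℂ := (σ : ℂ →+* ℂ) with hσ'def
  have hσ' : σ' (cexp (2 * π * Complex.I / N)) = cexp (2 * π * Complex.I * d / N) := hσ
  -- membership in `Λ_W` versus `L₁`, and the uniformisation on / off the lattice
  have hmemL : ∀ w : ℂ, w ∈ L₁.lattice ↔ (D₁.c : ℂ) * w ∈ D₁.L.lattice := fun w ↦ by
    rw [hL₁, PeriodPair.mem_mulLeft_lattice, inv_inv]
  have hker : ∀ w : ℂ, D₁.uniformize w = 0 ↔ w ∈ D₁.L.lattice := fun w ↦ by
    rw [← SetLike.mem_coe, ← D₁.ker_uniformize, SetLike.mem_coe, AddMonoidHom.mem_ker]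
  have hwp : ∀ w : ℂ, ℘[D₁.L] ((D₁.c : ℂ) * w) = ((D₁.c : ℂ) ^ 2)⁻¹ * ℘[L₁] w := fun w ↦ by
    have h := PeriodPair.weierstrassP_mulLeft ((D₁.c : ℂ)⁻¹) (inv_ne_zero hc) D₁.L ((D₁.c : ℂ) * w)
    rw [← mul_assoc, inv_mul_cancel₀ hc, one_mul, inv_pow, inv_inv] at h
    rw [← hL₁] at h
    rw [h, ← mul_assoc, inv_mul_cancel₀ (pow_ne_zero 2 hc), one_mul]
  have hwp' : ∀ w : ℂ, ℘'[D₁.L] ((D₁.c : ℂ) * w) = ((D₁.c : ℂ) ^ 3)⁻¹ * ℘'[L₁] w := fun w ↦ by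
    have h := PeriodPair.derivWeierstrassP_mulLeft ((D₁.c : ℂ)⁻¹) (inv_ne_zero hc) D₁.L ((D₁.c : ℂ) * w)
    rw [← mul_assoc, inv_mul_cancel₀ hc, one_mul, inv_pow, inv_inv] at h
    rw [← hL₁] at h
    rw [h, ← mul_assoc, inv_mul_cancel₀ (pow_ne_zero 3 hc), one_mul]
  -- `σ` fixes the (rational) coefficients of the model and `c`
  have hσb₂ : σ' (W.baseChange ℂ).b₂ = (W.baseChange ℂ).b₂ := by
    rw [show (W.baseChange ℂ).b₂ = ((W.b₂ : ℚ) : ℂ) by simp [WeierstrassCurve.baseChange, WeierstrassCurve.map_b₂], map_ratCast]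
  have hσa₁ : σ' (W.baseChange ℂ).a₁ = (W.baseChange ℂ).a₁ := by
    rw [show (W.baseChange ℂ).a₁ = ((W.a₁ : ℚ) : ℂ) by simp [WeierstrassCurve.baseChange], map_ratCast]
  have hσa₃ : σ' (W.baseChange ℂ).a₃ = (W.baseChange ℂ).a₃ := by
    rw [show (W.baseChange ℂ).a₃ = ((W.a₃ : ℚ) : ℂ) by simp [WeierstrassCurve.baseChange], map_ratCast]
  have hσc : σ' (D₁.c : ℂ) = (D₁.c : ℂ) := map_intCast σ' _
  -- the conclusion for two cusps `1/y`, `1/y'` from the alternative of `transport_cusp_values`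
  have key : ∀ {z z' : ℂ}, ((z ∈ L₁.lattice ∧ z' ∈ L₁.lattice) ∨
      (z ∉ L₁.lattice ∧ z' ∉ L₁.lattice ∧ ℘[L₁] z' = σ' (℘[L₁] z) ∧ ℘'[L₁] z' = σ' (℘'[L₁] z))) →
      WeierstrassCurve.Affine.Point.map (W' := W) (σ : ℂ →ₐ[ℚ] ℂ) (D₁.uniformize ((D₁.c : ℂ) * z)) =
        D₁.uniformize ((D₁.c : ℂ) * z') := by
    rintro z z' (⟨hz, hz'⟩ | ⟨hz, hz', hx, hy'⟩)
    · rw [(hker _).mpr ((hmemL z).mp hz), (hker _).mpr ((hmemL z').mp hz'), map_zero]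
    · obtain ⟨h₁, e₁⟩ := D₁.uniformize_spec _ (fun h ↦ hz ((hmemL z).mpr h))
      obtain ⟨h₂, e₂⟩ := D₁.uniformize_spec _ (fun h ↦ hz' ((hmemL z').mpr h))
      rw [e₁, e₂, WeierstrassCurve.Affine.Point.map_some]
      simp only [WeierstrassCurve.Affine.Point.some.injEq]
      have eσ : ∀ w : ℂ, (σ : ℂ →ₐ[ℚ] ℂ) w = σ' w := fun w ↦ rfl
      constructor <;>
        simp only [eσ, map_sub, map_div₀, map_mul, map_inv₀, map_pow, map_ofNat, hσb₂, hσa₁, hσa₃, hσc, hwp, hwp',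
          ← hx, ← hy']
  -- the two cusps of the statement
  have e1 : (1 / y : ℚ) = ((1 : ℤ) : ℚ) / ((y : ℤ) : ℚ) := by push_cast; rfl
  have e2 : (1 / (d' * y) : ℚ) = ((1 : ℤ) : ℚ) / ((d' * y : ℤ) : ℚ) := by push_cast; rfl
  rw [e1, e2]
  by_cases hd' : d' = 0
  · -- degenerate level: `dd' ≡ 1 (N)` with `d' = 0` forces `(1 : ZMod N) = 0`, so `Γ₁(N) = SL₂(ℤ)` and both cusp values
    -- are the origin
    have h01 : (0 : ZMod N) = 1 := by rw [← hdd, hd']; push_cast; ring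
    haveI : Subsingleton (ZMod N) := subsingleton_of_zero_eq_one h01
    have hall : ∀ g : SL(2, ℤ), g ∈ Gamma1 N := fun g ↦ by
      rw [Gamma1_mem]
      exact ⟨Subsingleton.elim _ _, Subsingleton.elim _ _, Subsingleton.elim _ _⟩
    set γ : SL(2, ℤ) := ⟨!![1, 0; y, 1], by simp [Matrix.det_fin_two_of]⟩ with hγdef
    have hγ10 : (γ 1 0 : ℤ) ≠ 0 := by simpa [hγdef] using hy
    have hz : modularSymbol D₁.f (((1 : ℤ) : ℚ) / ((y : ℤ) : ℚ)) ∈ L₁.lattice := by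
      have := modularSymbol_mem_of_gamma1 D₁ hc γ (hall γ) hγ10
      simpa [hγdef] using this
    have hS10 : ((ModularGroup.S : SL(2, ℤ)) 1 0 : ℤ) ≠ 0 := by simp [ModularGroup.S]
    have hz' : modularSymbol D₁.f (((1 : ℤ) : ℚ) / ((d' * y : ℤ) : ℚ)) ∈ L₁.lattice := by
      have := modularSymbol_mem_of_gamma1 D₁ hc ModularGroup.S (hall _) hS10
      rw [hd', zero_mul]
      simpa [ModularGroup.S] using this
    exact key (Or.inl ⟨hz, hz'⟩)
  · have hy' : d' * y ≠ 0 := mul_ne_zero hd' hy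
    have hyy : ((d' * y : ℤ) : ZMod N) = (d' : ZMod N) * (y : ZMod N) := by push_cast; ring
    exact key (transport_cusp_values D₁ hc σ' hσ' hdd hy hy' hyy)

end Summit.BirchSwinnertonDyer.BirchSwinnertonDyer.Theorems.ManinLocalTwoThree.StevensGalois

end
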